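import Literature.Computation.Certificates.CliqueBlockEmbedding
import Summits.Ventures.GridStability.Lyapunov.NE39SPSlabCData
import Summits.Ventures.GridStability.Lyapunov.NE39SPSlabCGram01
import Summits.Ventures.GridStability.Lyapunov.NE39SPSlabCGram02
import Summits.Ventures.GridStability.Lyapunov.NE39SPSlabCGram03
import Summits.Ventures.GridStability.Lyapunov.NE39SPSlabCGram04
import Summits.Ventures.GridStability.Lyapunov.NE39SPSlabCGram05
import Summits.Ventures.GridStability.Lyapunov.NE39SPSlabCGram06
import Summits.Ventures.GridStability.Lyapunov.NE39SPSlabCGram07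
import Summits.Ventures.GridStability.Lyapunov.NE39SPSlabCGram08
import Summits.Ventures.GridStability.Lyapunov.NE39SPSlabCGram09
import Summits.Ventures.GridStability.Lyapunov.NE39SPSlabCGram10
import Summits.Ventures.GridStability.Lyapunov.NE39SPSlabCGram11
import Summits.Ventures.GridStability.Lyapunov.NE39SPSlabCGramP1
import Summits.Ventures.GridStability.Lyapunov.NE39SPSlabCGramP2
import Summits.Ventures.GridStability.Lyapunov.NE39SPSlabCGramP3

/-!
# GridStability/Lyapunov/NE39SPSlabCSum — «G2.b-NE39SP-SLAB-CLQ» (#53): the explicit clique sums (definitions only)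

Cell `gridfusion` (LADDER-GRIDFUSION G2, SP–Lur'e lane), row candidate «G2.b-NE39SP-SLAB-CLQ» (#53; lead RULING (R-a) AMENDED
2026-08-27T08:21:56Z «sos-4: FILE PSD»): the n = 58 structure-preserving NE39 slab row by the CLIQUE route. OBJECT `NE39SP.relLurie D`
(Models/NE39SPLurie.lean: 58 states `Fin 48 ⊕ Fin 10`, 56 lines, reference bus 39) with D = `1/10` at all 49 nodes — SYNTHETIC
uniform damping (declared; MODEL-VALIDITY SP–Lur'e block). CERTIFICATE (seat gridfusion-sos-4 g4, kit j272825, file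
`cert/sos-4/j272825/lchord-R5-NE39SP-D1o10-nbr-csJ.json` sha16 3f9f274c5104abf6): a Lur'e–Postnikov slab certificate (slab `u = 1/4`, sectors `a = 5/8`,
`b = 1`, `η = 1/1000`, Popov on all 56 lines) whose Lyapunov matrix `P` is STRUCTURED (nonzero 2-node blocks only on network
lines, pattern «nbr») so that `−𝓛` (114 × 114) is the SUM of 64 clique-embedded blocks ≤ 19 × 19 and `P − ε·1` (58 × 58) the sum
of 41 blocks ≤ 4 × 4 [cite: ZhengFantuzziPapachristodoulou2018, §3.2 Theorem 2 (Agler)], every block carrying an integer Gram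
certificate of ≤ 35 digits (solver: Clarabel on a per-index Jacobi-scaled LMI, objective = maximise the common block margin δ (ε_P = κδ, κ = 1); dyadic rounding,
Peyrl–Parrilo projection onto the clique identities, exact re-verification — all VALIDATED-column provenance). DATA module:
`Summits.Ventures.GridStability.Lyapunov.NE39SPSlabCData` (`AqS`, `PSq`, `epsSQ`, `tauSQ`, `lamSQ`; typed by gridfusion-model-2 (p514683) from sos-4's hand-over 5a053876f8a67723 — literals re-matched exactly against this certificate by the generator's companion check). Index convention
(global LMI index `Fin 114`): `i < 48` ↦ state `inl i` (relative angle), `48 + j` ↦ state `inr j` (machine speed), `58 + e` ↦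
line/channel `e` — i.e. model-2's `e2 : (Fin 48 ⊕ Fin 10) ⊕ Fin 56 ≃ Fin 114`. THREE COLUMNS: these files are exact DATA +
kernel-decided PSD facts about the literal matrices `AqS` / `PSq − ε·1`; that `AqS` IS `−slabMatrix (relLurie D) P η λ τ a b` is the
Bench/Id step (model-2); nothing here says the New England system is stable; the region these data will certify is an inner
estimate for a structure-preserving NE39 VARIANT with DECLARED SYNTHETIC damping. Generator `sos4/gen_slabS_lean.py` (HOME/cert/sos-4/).

This file: `sumL` = the explicit 64-term sum `Σ_c embedAt (listIdx members_c) S_c` on `Fin 114` and `sumP` = the 41-term sum on `Fin 58`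
(left-associated, so that the PSD assembly is a chain of `PosSemidef.add_embedAt`). No proofs.
-/

set_option linter.style.longLine false
set_option maxRecDepth 100000

open Matrix Literature.Computation.Certificates

namespace Summit.Ventures.GridStability.Lyapunov.NE39SPSlabC

/-- **the clique sum of the 64 `−𝓛` blocks** (explicit, left-associated). [cite: ZhengFantuzziPapachristodoulou2018, §3.2 Theorem 2] -/
def sumL : Matrix (Fin 114) (Fin 114) ℚ :=
  PSD.embedAt (PSD.listIdx mL_0) sqL_0
  + PSD.embedAt (PSD.listIdx mL_1) sqL_1
  + PSD.embedAt (PSD.listIdx mL_2) sqL_2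
  + PSD.embedAt (PSD.listIdx mL_3) sqL_3
  + PSD.embedAt (PSD.listIdx mL_4) sqL_4
  + PSD.embedAt (PSD.listIdx mL_5) sqL_5
  + PSD.embedAt (PSD.listIdx mL_6) sqL_6
  + PSD.embedAt (PSD.listIdx mL_7) sqL_7
  + PSD.embedAt (PSD.listIdx mL_8) sqL_8
  + PSD.embedAt (PSD.listIdx mL_9) sqL_9
  + PSD.embedAt (PSD.listIdx mL_10) sqL_10
  + PSD.embedAt (PSD.listIdx mL_11) sqL_11
  + PSD.embedAt (PSD.listIdx mL_12) sqL_12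
  + PSD.embedAt (PSD.listIdx mL_13) sqL_13
  + PSD.embedAt (PSD.listIdx mL_14) sqL_14
  + PSD.embedAt (PSD.listIdx mL_15) sqL_15
  + PSD.embedAt (PSD.listIdx mL_16) sqL_16
  + PSD.embedAt (PSD.listIdx mL_17) sqL_17
  + PSD.embedAt (PSD.listIdx mL_18) sqL_18
  + PSD.embedAt (PSD.listIdx mL_19) sqL_19
  + PSD.embedAt (PSD.listIdx mL_20) sqL_20
  + PSD.embedAt (PSD.listIdx mL_21) sqL_21
  + PSD.embedAt (PSD.listIdx mL_22) sqL_22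
  + PSD.embedAt (PSD.listIdx mL_23) sqL_23
  + PSD.embedAt (PSD.listIdx mL_24) sqL_24
  + PSD.embedAt (PSD.listIdx mL_25) sqL_25
  + PSD.embedAt (PSD.listIdx mL_26) sqL_26
  + PSD.embedAt (PSD.listIdx mL_27) sqL_27
  + PSD.embedAt (PSD.listIdx mL_28) sqL_28
  + PSD.embedAt (PSD.listIdx mL_29) sqL_29
  + PSD.embedAt (PSD.listIdx mL_30) sqL_30
  + PSD.embedAt (PSD.listIdx mL_31) sqL_31
  + PSD.embedAt (PSD.listIdx mL_32) sqL_32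
  + PSD.embedAt (PSD.listIdx mL_33) sqL_33
  + PSD.embedAt (PSD.listIdx mL_34) sqL_34
  + PSD.embedAt (PSD.listIdx mL_35) sqL_35
  + PSD.embedAt (PSD.listIdx mL_36) sqL_36
  + PSD.embedAt (PSD.listIdx mL_37) sqL_37
  + PSD.embedAt (PSD.listIdx mL_38) sqL_38
  + PSD.embedAt (PSD.listIdx mL_39) sqL_39
  + PSD.embedAt (PSD.listIdx mL_40) sqL_40
  + PSD.embedAt (PSD.listIdx mL_41) sqL_41
  + PSD.embedAt (PSD.listIdx mL_42) sqL_42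
  + PSD.embedAt (PSD.listIdx mL_43) sqL_43
  + PSD.embedAt (PSD.listIdx mL_44) sqL_44
  + PSD.embedAt (PSD.listIdx mL_45) sqL_45
  + PSD.embedAt (PSD.listIdx mL_46) sqL_46
  + PSD.embedAt (PSD.listIdx mL_47) sqL_47
  + PSD.embedAt (PSD.listIdx mL_48) sqL_48
  + PSD.embedAt (PSD.listIdx mL_49) sqL_49
  + PSD.embedAt (PSD.listIdx mL_50) sqL_50
  + PSD.embedAt (PSD.listIdx mL_51) sqL_51
  + PSD.embedAt (PSD.listIdx mL_52) sqL_52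
  + PSD.embedAt (PSD.listIdx mL_53) sqL_53
  + PSD.embedAt (PSD.listIdx mL_54) sqL_54
  + PSD.embedAt (PSD.listIdx mL_55) sqL_55
  + PSD.embedAt (PSD.listIdx mL_56) sqL_56
  + PSD.embedAt (PSD.listIdx mL_57) sqL_57
  + PSD.embedAt (PSD.listIdx mL_58) sqL_58
  + PSD.embedAt (PSD.listIdx mL_59) sqL_59
  + PSD.embedAt (PSD.listIdx mL_60) sqL_60
  + PSD.embedAt (PSD.listIdx mL_61) sqL_61
  + PSD.embedAt (PSD.listIdx mL_62) sqL_62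
  + PSD.embedAt (PSD.listIdx mL_63) sqL_63

/-- **the clique sum of the 41 `P − ε·1` blocks** (explicit, left-associated). [cite: ZhengFantuzziPapachristodoulou2018, §3.2 Theorem 2] -/
def sumP : Matrix (Fin 58) (Fin 58) ℚ :=
  PSD.embedAt (PSD.listIdx mP_0) sqP_0
  + PSD.embedAt (PSD.listIdx mP_1) sqP_1
  + PSD.embedAt (PSD.listIdx mP_2) sqP_2
  + PSD.embedAt (PSD.listIdx mP_3) sqP_3
  + PSD.embedAt (PSD.listIdx mP_4) sqP_4
  + PSD.embedAt (PSD.listIdx mP_5) sqP_5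
  + PSD.embedAt (PSD.listIdx mP_6) sqP_6
  + PSD.embedAt (PSD.listIdx mP_7) sqP_7
  + PSD.embedAt (PSD.listIdx mP_8) sqP_8
  + PSD.embedAt (PSD.listIdx mP_9) sqP_9
  + PSD.embedAt (PSD.listIdx mP_10) sqP_10
  + PSD.embedAt (PSD.listIdx mP_11) sqP_11
  + PSD.embedAt (PSD.listIdx mP_12) sqP_12
  + PSD.embedAt (PSD.listIdx mP_13) sqP_13
  + PSD.embedAt (PSD.listIdx mP_14) sqP_14
  + PSD.embedAt (PSD.listIdx mP_15) sqP_15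
  + PSD.embedAt (PSD.listIdx mP_16) sqP_16
  + PSD.embedAt (PSD.listIdx mP_17) sqP_17
  + PSD.embedAt (PSD.listIdx mP_18) sqP_18
  + PSD.embedAt (PSD.listIdx mP_19) sqP_19
  + PSD.embedAt (PSD.listIdx mP_20) sqP_20
  + PSD.embedAt (PSD.listIdx mP_21) sqP_21
  + PSD.embedAt (PSD.listIdx mP_22) sqP_22
  + PSD.embedAt (PSD.listIdx mP_23) sqP_23
  + PSD.embedAt (PSD.listIdx mP_24) sqP_24
  + PSD.embedAt (PSD.listIdx mP_25) sqP_25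
  + PSD.embedAt (PSD.listIdx mP_26) sqP_26
  + PSD.embedAt (PSD.listIdx mP_27) sqP_27
  + PSD.embedAt (PSD.listIdx mP_28) sqP_28
  + PSD.embedAt (PSD.listIdx mP_29) sqP_29
  + PSD.embedAt (PSD.listIdx mP_30) sqP_30
  + PSD.embedAt (PSD.listIdx mP_31) sqP_31
  + PSD.embedAt (PSD.listIdx mP_32) sqP_32
  + PSD.embedAt (PSD.listIdx mP_33) sqP_33
  + PSD.embedAt (PSD.listIdx mP_34) sqP_34
  + PSD.embedAt (PSD.listIdx mP_35) sqP_35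
  + PSD.embedAt (PSD.listIdx mP_36) sqP_36
  + PSD.embedAt (PSD.listIdx mP_37) sqP_37
  + PSD.embedAt (PSD.listIdx mP_38) sqP_38
  + PSD.embedAt (PSD.listIdx mP_39) sqP_39
  + PSD.embedAt (PSD.listIdx mP_40) sqP_40

/-- `P − ε·1`. -/
def PeS : Matrix (Fin 58) (Fin 58) ℚ := PSq - epsSQ • (1 : Matrix (Fin 58) (Fin 58) ℚ)

end Summit.Ventures.GridStability.Lyapunov.NE39SPSlabC
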